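import Literature.NumberTheory.LFunctions.NicolasChainSound
import Literature.NumberTheory.LFunctions.NicolasChainRun
import Literature.NumberTheory.LFunctions.NicolasLogfUpperRH
import Literature.NumberTheory.LFunctions.SchoenfeldThetaLarge
import Literature.NumberTheory.Multiplicative.ChebyshevThetaExplicit
import Mathlib.Analysis.SpecialFunctions.Pow.Asymptotics
import HarnessLib

/-!
# RH-EQUIVALENT — Nicolas's criterion `nicolas_iff` PROVED: `RH ⟺ N_k/φ(N_k) > e^γ log log N_k` for every primorial `N_k`; `c(N_k)` unbounded if RH fails (`Nicolas2012_nicolasC_primorial_unbounded` DISCHARGED)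

RH-EQUIVALENT (a proved equivalence; nothing here bears on the truth of RH). Literature-typing
tranche 1: discharge of the named fact `Literature.NumberTheory.LFunctions.nicolas_iff`
(`NicolasCriterion.lean`; Nicolas 1983, Thm. 2; Broughan, *Equivalents of RH* vol. 1, §5.6) —
**`nicolas_iff_holds : nicolas_iff`**. The `⟸` half (Thm. 2 (b)) was already proved there
(`riemannHypothesis_of_nicolasInequality_primorial`, from `Nicolas.Nicolas1983_thm2b`); this file
supplies the `⟹` half, **Nicolas 1983, Thm. 2 (a)**: under RH, `e^γ log log(p#) < p#/φ(p#)` for every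
prime `p` (`Nicolas1983_thm2a`), assembled from

* the analytic range `p ≥ 599² = 358801` under RH (`NicolasUpper.nicolasInequality_primorial_of_RH_of_le`,
  `NicolasLogfUpperRH.lean`: Nicolas 2012, Prop. 2.1 upper half, with Schoenfeld's `θ` bound under
  RH as the hypothesis `Schoenfeld1976_theta`, discharged by the tree's `Schoenfeld1976_theta_holds`);
* the finite range `p ≤ 360649`, RH-free, by the kernel-certified Nicolas chain
  (`NicolasChainCheck.lean`, `NicolasChainSound.lean`, `NicolasChainRun.lean`):
  `nicolasInequality_primorial_of_le` (standard axioms; Nicolas 1983/2012 settle small `k` by a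
  computation too — 2012, §4, `k ≤ π(10⁹)`).

`nicolas_iff_of_schoenfeld (hS : Schoenfeld1976_theta) : nicolas_iff` has standard axioms;
`nicolas_iff_holds` inherits the computational closure of `Schoenfeld1976_theta_holds` (like
`robin_iff_holds`). Corollaries: `riemannHypothesis_iff_nicolasInequality_primorial` (the criterion as
an `Iff` theorem) and its eventual form `riemannHypothesis_iff_nicolasInequality_primorial_eventually`.

Appended: the DISCHARGE **`Nicolas2012_nicolasC_primorial_unbounded_holds`** of the second named fact of
`NicolasCriterion.lean` (Nicolas 2012, p. 3: if RH fails, `c(N_k)` is unbounded above and below along the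
primorials; standard axioms), transferred — exactly as printed, "it follows from (1.10)" — from the tree's
PROVED `Ω±` theorem `Nicolas.Nicolas1983_logf_omega_pm` through
`c(p#) = (p#/φ(p#))(1 − f(p))√(log p#)` (`NicolasCUnbounded.nicolasC_primorial_eq`), the step structure of
`f` (`Nicolas.exists_prime_nicolasF_eq`, Bertrand) and `θ(p) ≥ p/4` (`quarter_le_theta`); with the RH-free
corollary `riemannHypothesis_of_nicolasC_primorial_bddBelow` (Cor. 1.1 for (1.7), `⟸`).

## References

* J.-L. Nicolas, *Petites valeurs de la fonction d'Euler*, J. Number Theory 17 (1983), 375–388,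
  Thm. 2. [Nicolas1983]
* J.-L. Nicolas, *Small values of the Euler function and the Riemann hypothesis*, Acta Arith. 155
  (2012), 311–321, p. 311 and Prop. 2.1. [Nicolas2012]
* K. Broughan, *Equivalents of the Riemann Hypothesis. Vol. 1*, CUP 2017, §5.6 "Nicolas' First
  Theorem" (pp. 135–137). [Broughan2017Arithmetic]
-/

namespace Literature.NumberTheory.LFunctions

open NicolasChain NicolasChainRun

/-- **The finished Nicolas run**: the invariant holds at the final state (prime `360649`), by
`initN_inv` and two applications of `runDN_sound` along the kernel facts `run1`, `run2`.
[cite: Nicolas1983, Thm. 2 (a)] -/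
theorem NicolasChain.inv_final :
    Inv ⟨360649, 15469004315349700887174786, 15469004315350176493980174,
        435316248904815008284154965780, 27555502256890831221541507⟩ := by
  have h0 : Inv initN := initN_inv
  have h1 := runDN_sound h0 run1
  exact runDN_sound h1 run2

/-- **Nicolas's inequality at the small primorials (PROVED, RH-free, kernel certificate)**:
`e^γ log log(p#) < p#/φ(p#)` for every prime `p ≤ 360649`.
[cite: Nicolas1983, Thm. 2 (a); Nicolas2012, Thm. 1.1 (1.7)] -/
theorem nicolasInequality_primorial_of_le {p : ℕ} (hp : p.Prime) (hle : p ≤ 360649) :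
    nicolasInequality (primorial p) :=
  nicolasInequality_of_inv NicolasChain.inv_final hp hle

/-- **Nicolas 1983, Thm. 2 (a), from Schoenfeld's bound (PROVED, standard axioms)**: under RH,
Nicolas's inequality holds at every primorial `p#`, `p` prime. [cite: Nicolas1983, Thm. 2 (a)] -/
theorem Nicolas1983_thm2a_of_schoenfeld (hS : Schoenfeld1976_theta) (hRH : RiemannHypothesis)
    {p : ℕ} (hp : p.Prime) : nicolasInequality (primorial p) := by
  rcases le_or_gt p 360649 with h | h
  · exact nicolasInequality_primorial_of_le hp h
  · exact NicolasUpper.nicolasInequality_primorial_of_RH_of_le hS hRH (by omega)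

/-- **Nicolas 1983, Thm. 2 (a) (PROVED)**: under the Riemann hypothesis,
`N_k/φ(N_k) > e^γ log log N_k` for every primorial `N_k = p#` (`p` prime).
[cite: Nicolas1983, Thm. 2 (a); Broughan2017Arithmetic, §5.6] -/
theorem Nicolas1983_thm2a (hRH : RiemannHypothesis) {p : ℕ} (hp : p.Prime) :
    nicolasInequality (primorial p) :=
  Nicolas1983_thm2a_of_schoenfeld Schoenfeld1976_theta_holds hRH hp

/-- **Nicolas's criterion from Schoenfeld's bound (PROVED, standard axioms).**
[cite: Nicolas1983, Thm. 2] -/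
theorem nicolas_iff_of_schoenfeld (hS : Schoenfeld1976_theta) : nicolas_iff :=
  ⟨fun hRH _ hp => Nicolas1983_thm2a_of_schoenfeld hS hRH hp,
    riemannHypothesis_of_nicolasInequality_primorial⟩

/-- **DISCHARGE of the named fact `nicolas_iff` — Nicolas's criterion (Nicolas 1983, Thm. 2):
RH `⟺` `e^γ log log N_k < N_k/φ(N_k)` for every primorial `N_k`.**
[cite: Nicolas1983, Thm. 2; Nicolas2012, p. 311; Broughan2017Arithmetic, §5.6] -/
theorem nicolas_iff_holds : nicolas_iff :=
  nicolas_iff_of_schoenfeld Schoenfeld1976_theta_holds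

/-- **Nicolas's criterion as a theorem**: RH `⟺` Nicolas's inequality at every primorial `p#`,
`p` prime. [cite: Nicolas1983, Thm. 2; Broughan2017Arithmetic, §5.6] -/
theorem riemannHypothesis_iff_nicolasInequality_primorial :
    RiemannHypothesis ↔ ∀ p : ℕ, p.Prime → nicolasInequality (primorial p) :=
  nicolas_iff_holds

/-- **Eventual form**: for every real `K`, RH `⟺` Nicolas's inequality at every primorial `p#` with
`p ≥ K` prime (Thm. 2 (a) + (b)). [cite: Nicolas1983, Thm. 2] -/
theorem riemannHypothesis_iff_nicolasInequality_primorial_eventually (K : ℝ) :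
    RiemannHypothesis ↔ ∀ p : ℕ, p.Prime → K ≤ p → nicolasInequality (primorial p) :=
  nicolas_iff_holds.eventually_iff K

/-! ### Nicolas 2012, p. 3: if RH fails, `c(N_k)` is unbounded above and below (DISCHARGE of
`Nicolas2012_nicolasC_primorial_unbounded`) -/

namespace NicolasCUnbounded

/-- `c(p#)` in terms of Nicolas's `f(p)`: `c(p#) = (p#/φ(p#)) · (1 − f(p)) · √(log p#)` — the exact
form of Nicolas 2012, p. 3, "`log f(p_k) ∼ (φ(N_k)/N_k) · c(N_k)/√(log N_k)`", from
`f(m) = e^γ log log m# · φ(m#)/m#` (`Nicolas.nicolasF_natCast_eq`). [cite: Nicolas2012, p. 3] -/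
theorem nicolasC_primorial_eq (p : ℕ) :
    nicolasC (primorial p) = (primorial p : ℝ) / Nat.totient (primorial p) *
      ((1 - nicolasF p) * Real.sqrt (Real.log (primorial p))) := by
  have hN0 : (0 : ℝ) < primorial p := by exact_mod_cast primorial_pos p
  have hφ0 : (0 : ℝ) < Nat.totient (primorial p) := by
    exact_mod_cast Nat.totient_pos.2 (primorial_pos p)
  rw [nicolasC, Nicolas.nicolasF_natCast_eq]
  field_simp

/-- `p#/φ(p#) ≥ 1`. [folklore] -/
private theorem one_le_primorial_div_totient (p : ℕ) :
    (1 : ℝ) ≤ (primorial p : ℝ) / Nat.totient (primorial p) := by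
  have hφ0 : (0 : ℝ) < Nat.totient (primorial p) := by
    exact_mod_cast Nat.totient_pos.2 (primorial_pos p)
  rw [one_le_div hφ0]
  exact_mod_cast Nat.totient_le (primorial p)

/-- `√(log p#) ≥ √x/4` for a prime `p > (x − 1)/2`, `p ≥ 3`, `x ≥ 2` (`log p# = θ(p) ≥ p/4 ≥ x/16`, the
tree's effective Chebyshev bound `quarter_le_theta`). [folklore] -/
private theorem sqrt_div_four_le {x : ℝ} {p : ℕ} (hx : 2 ≤ x) (hp3 : 3 ≤ p) (hpx : (x - 1) / 2 < p) :
    Real.sqrt x / 4 ≤ Real.sqrt (Real.log (primorial p)) := by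
  have hθ : Chebyshev.theta (p : ℝ) = Real.log (primorial p) := by
    rw [Chebyshev.theta_eq_log_primorial, Nat.floor_natCast]
  have hq := Literature.NumberTheory.Multiplicative.quarter_le_theta (x := (p : ℝ)) (by exact_mod_cast hp3)
  rw [hθ] at hq
  have hL : x / 16 ≤ Real.log (primorial p) := by linarith
  calc Real.sqrt x / 4 = Real.sqrt (x / 16) := by
        rw [Real.sqrt_div' x (by norm_num : (0 : ℝ) ≤ 16), show (16 : ℝ) = 4 ^ 2 by norm_num,
          Real.sqrt_sq (by norm_num)]
    _ ≤ Real.sqrt (Real.log (primorial p)) := Real.sqrt_le_sqrt hL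

/-- `√x · x^{−b} = x^{1/2 − b}` for `x > 0`. [folklore] -/
private theorem sqrt_mul_rpow_neg {x b : ℝ} (hx : 0 < x) :
    Real.sqrt x * x ^ (-b) = x ^ (1 / 2 - b) := by
  rw [Real.sqrt_eq_rpow, ← Real.rpow_add hx]
  ring_nf

/-- `e^{−u} ≤ 1 − u/2` for `0 ≤ u ≤ 1` (from `1 + u ≤ e^u` and `(1 − u/2)(1 + u) ≥ 1`). [folklore] -/
private theorem exp_neg_le {u : ℝ} (hu0 : 0 ≤ u) (hu1 : u ≤ 1) : Real.exp (-u) ≤ 1 - u / 2 := by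
  have hE := Real.exp_pos (-u)
  have h1 : Real.exp (-u) * (u + 1) ≤ 1 := by
    calc Real.exp (-u) * (u + 1) ≤ Real.exp (-u) * Real.exp u :=
          mul_le_mul_of_nonneg_left (Real.add_one_le_exp u) hE.le
      _ = 1 := by rw [← Real.exp_add]; simp
  have h2 : (1 : ℝ) ≤ (1 - u / 2) * (u + 1) := by nlinarith
  exact le_of_mul_le_mul_right (h1.trans h2) (by linarith)

/-- The common transfer step. For `x ≥ 7` there is a prime `p` with `(x − 1)/2 < p ≤ x`, `f(p) = f(x)`
(`Nicolas.exists_prime_nicolasF_eq`), and then, with `u = x^{−b} ∈ (0, 1]`: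
`log f(x) ≥ u ⟹ c(p#) ≤ −x^{1/2−b}/4` and `log f(x) ≤ −u ⟹ c(p#) ≥ x^{1/2−b}/8`.
[cite: Nicolas2012, p. 3; Nicolas1983, Thm. 3 (c)] -/
theorem exists_prime_nicolasC_le_or_ge {x b : ℝ} (hx : 7 ≤ x) (hb0 : 0 < b) :
    ∃ p : ℕ, p.Prime ∧ (x - 1) / 2 < p ∧
      (x ^ (-b) ≤ Real.log (nicolasF x) → nicolasC (primorial p) ≤ -(x ^ (1 / 2 - b) / 4)) ∧
      (Real.log (nicolasF x) ≤ -x ^ (-b) → x ^ (1 / 2 - b) / 8 ≤ nicolasC (primorial p)) := by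
  have hx2 : 2 ≤ x := by linarith
  have hx0 : 0 < x := by linarith
  obtain ⟨p, hp, hpx, -, hfp⟩ := Nicolas.exists_prime_nicolasF_eq hx2
  have hp3 : 3 ≤ p := by
    have : (3 : ℝ) ≤ p := by linarith
    exact_mod_cast this
  refine ⟨p, hp, hpx, ?_, ?_⟩
  · intro hge
    have hF := nicolasF_pos (show (3 : ℝ) ≤ x by linarith)
    rw [← hfp] at hF hge
    set F := nicolasF p with hFdef
    set u : ℝ := x ^ (-b) with hudef
    have hu0 : 0 < u := Real.rpow_pos_of_pos hx0 _
    -- `F ≥ 1 + log F ≥ 1 + u`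
    have hF1 : 1 + u ≤ F := by
      have h := Real.add_one_le_exp (Real.log F)
      rw [Real.exp_log hF] at h
      linarith
    set S := Real.sqrt (Real.log (primorial p)) with hSdef
    have hS := sqrt_div_four_le hx2 hp3 hpx
    have hS0 : 0 ≤ S := Real.sqrt_nonneg _
    have ht : (1 - F) * S ≤ -(u * (Real.sqrt x / 4)) := by
      have h1 : (1 - F) * S ≤ -u * S := mul_le_mul_of_nonneg_right (by linarith) hS0
      have h2 : u * (Real.sqrt x / 4) ≤ u * S := mul_le_mul_of_nonneg_left hS hu0.le
      linarith
    have ht0 : (1 - F) * S ≤ 0 := by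
      have : 0 ≤ u * (Real.sqrt x / 4) := by positivity
      linarith
    have hR := one_le_primorial_div_totient p
    rw [nicolasC_primorial_eq, ← hFdef]
    set R := (primorial p : ℝ) / Nat.totient (primorial p) with hRdef
    have hRt : R * ((1 - F) * S) ≤ (1 - F) * S := by
      have hm : 0 ≤ (R - 1) * (-((1 - F) * S)) := mul_nonneg (by linarith) (by linarith)
      nlinarith
    have hpow : u * (Real.sqrt x / 4) = x ^ (1 / 2 - b) / 4 := by
      rw [hudef, ← sqrt_mul_rpow_neg hx0]; ring
    linarith
  · intro hle
    have hF := nicolasF_pos (show (3 : ℝ) ≤ x by linarith)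
    rw [← hfp] at hF hle
    set F := nicolasF p with hFdef
    set u : ℝ := x ^ (-b) with hudef
    have hu0 : 0 < u := Real.rpow_pos_of_pos hx0 _
    have hu1 : u ≤ 1 := Real.rpow_le_one_of_one_le_of_nonpos (by linarith) (by linarith)
    -- `F ≤ e^{−u} ≤ 1 − u/2`
    have hF1 : F ≤ 1 - u / 2 := by
      have h : F ≤ Real.exp (-u) := by
        rw [← Real.exp_log hF]; exact Real.exp_le_exp.2 hle
      exact h.trans (exp_neg_le hu0.le hu1)
    set S := Real.sqrt (Real.log (primorial p)) with hSdef
    have hS := sqrt_div_four_le hx2 hp3 hpx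
    have hS0 : 0 ≤ S := Real.sqrt_nonneg _
    have ht : u / 2 * (Real.sqrt x / 4) ≤ (1 - F) * S := by
      have h1 : u / 2 * S ≤ (1 - F) * S := mul_le_mul_of_nonneg_right (by linarith) hS0
      have h2 : u / 2 * (Real.sqrt x / 4) ≤ u / 2 * S := mul_le_mul_of_nonneg_left hS (by linarith)
      linarith
    have ht0 : 0 ≤ (1 - F) * S := by
      have : 0 ≤ u / 2 * (Real.sqrt x / 4) := by positivity
      linarith
    have hR := one_le_primorial_div_totient p
    rw [nicolasC_primorial_eq, ← hFdef]
    set R := (primorial p : ℝ) / Nat.totient (primorial p) with hRdef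
    have hRt : (1 - F) * S ≤ R * ((1 - F) * S) := le_mul_of_one_le_left ht0 hR
    have hpow : u / 2 * (Real.sqrt x / 4) = x ^ (1 / 2 - b) / 8 := by
      rw [hudef, ← sqrt_mul_rpow_neg hx0]; ring
    linarith

end NicolasCUnbounded

/-- **DISCHARGE of `Nicolas2012_nicolasC_primorial_unbounded`** (Nicolas 2012, p. 3: "it follows from
(1.10) that, if the Riemann hypothesis does not hold, then `lim inf c(n) = −∞` and
`lim sup c(n) = +∞`", along the primorials): if RH fails then for all real `A`, `X` there are primes
`p > X` with `c(p#) < A` and primes `p > X` with `A < c(p#)`. Proof as printed: by (1.10) — the tree's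
PROVED `Nicolas.Nicolas1983_logf_omega_pm` (Nicolas 1983, Thm. 3 (c)) — `log f(x) ≥ x^{−b}`, resp.
`≤ −x^{−b}`, for arbitrarily large `x`, some `0 < b < 1/2`; `f` is constant between consecutive
primes (`f(x) = f(p)`, `p > (x−1)/2`, Bertrand), `c(p#) = (p#/φ(p#))(1 − f(p))√(log p#)` and
`log p# = θ(p) ≥ p/4`, so `c(p#) ≤ −x^{1/2−b}/4 → −∞`, resp. `c(p#) ≥ x^{1/2−b}/8 → +∞`.
Standard axioms. [cite: Nicolas2012, p. 3 (lim inf / lim sup of c if RH fails, from (1.10)); Nicolas1983, Thm. 3 (c)] -/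
theorem Nicolas2012_nicolasC_primorial_unbounded_holds : Nicolas2012_nicolasC_primorial_unbounded := by
  intro hRH
  obtain ⟨b, hb0, hb, h⟩ := Nicolas.Nicolas1983_logf_omega_pm hRH
  obtain ⟨hminus, hplus⟩ := h 1 one_pos
  have he : 0 < 1 / 2 - b := by linarith
  -- growth of `x^{1/2 − b}`
  have hgrow : ∀ A : ℝ, ∃ X₁ : ℝ, ∀ x : ℝ, X₁ ≤ x → 8 * (|A| + 1) ≤ x ^ (1 / 2 - b) := fun A =>
    Filter.eventually_atTop.1 ((tendsto_rpow_atTop he).eventually_ge_atTop (8 * (|A| + 1)))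
  constructor
  · intro A X
    obtain ⟨X₁, hX₁⟩ := hgrow A
    obtain ⟨x, hx, hfx⟩ := hplus (max (max (2 * X + 1) 7) X₁)
    have hx7 : 7 ≤ x := le_trans (le_trans (le_max_right _ _) (le_max_left _ _)) hx.le
    have hxX : 2 * X + 1 < x := lt_of_le_of_lt (le_trans (le_max_left _ _) (le_max_left _ _)) hx
    have hxX₁ : X₁ ≤ x := le_trans (le_max_right _ _) hx.le
    obtain ⟨p, hp, hpx, hle, -⟩ := NicolasCUnbounded.exists_prime_nicolasC_le_or_ge hx7 hb0
    refine ⟨p, hp, by linarith, ?_⟩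
    have h1 := hle (by simpa using hfx)
    have h2 := hX₁ x hxX₁
    have h3 := neg_abs_le A
    have h4 := abs_nonneg A
    linarith
  · intro A X
    obtain ⟨X₁, hX₁⟩ := hgrow A
    obtain ⟨x, hx, hfx⟩ := hminus (max (max (2 * X + 1) 7) X₁)
    have hx7 : 7 ≤ x := le_trans (le_trans (le_max_right _ _) (le_max_left _ _)) hx.le
    have hxX : 2 * X + 1 < x := lt_of_le_of_lt (le_trans (le_max_left _ _) (le_max_left _ _)) hx
    have hxX₁ : X₁ ≤ x := le_trans (le_max_right _ _) hx.le
    obtain ⟨p, hp, hpx, -, hge⟩ := NicolasCUnbounded.exists_prime_nicolasC_le_or_ge hx7 hb0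
    refine ⟨p, hp, by linarith, ?_⟩
    have h1 := hge (by simpa using hfx)
    have h2 := hX₁ x hxX₁
    have h3 := le_abs_self A
    linarith

/-- Hence **Nicolas 2012, Cor. 1.1 for (1.7), `⟸` half, unconditionally** (PROVED): if `c(p#) ≥ c(2)`
for every prime `p` — or merely `c(p#)` bounded below along the primes beyond some point — then RH.
[cite: Nicolas2012, Cor. 1.1 (for (1.7))] -/
theorem riemannHypothesis_of_nicolasC_primorial_bddBelow {A X : ℝ}
    (h : ∀ p : ℕ, p.Prime → X < p → A ≤ nicolasC (primorial p)) : RiemannHypothesis := by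
  by_contra hRH
  obtain ⟨p, hp, hXp, hlt⟩ := (Nicolas2012_nicolasC_primorial_unbounded_holds hRH).1 A X
  exact absurd (h p hp hXp) (not_le.2 hlt)

end Literature.NumberTheory.LFunctions
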